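import Summits.CriticalPhenomena.PercolationContinuityZ3.Theorems.PercNearOneGluingNoHeavyLowerTailKnQuestion8CoefficientwiseCoreClassKernelMixMergedScheme
import Summits.CriticalPhenomena.PercolationContinuityZ3.Theorems.PercNearOneGluingNoHeavyLowerTailKnQuestion8CoefficientwiseCoreClassKernelMixBundleFibreTransfer
import HarnessLib

/-!
# Chorded bundles, II: the general fibre scheme INSIDE a red-prefix class (class thread + two flag threads)

Support file (`--supports stmt-CriticalPhenomena-4575`, closed), prover `prim-cplus-coupling` (gen 60).  No definitions, no notations, no named facts,
no sorries; standard axioms.  Memo `prim-cplus-coupling/A5-COUPLING-gen60.md` §1 (the CLASS THEOREM for `Θ(ℓ₀,ℓ₁,ℓ₂,1)`).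

SETTING.  An explicit bundle `Θ(ℓ₁..ℓ_r)` as in `…KernelMixBundleBoundary`; a class thread `z` with class index `1 ≤ a`, `a + 1 ≤ L z` (the RED-PREFIX CLASS
`R_a(z) = {ω : e z 1, …, e z a ∈ ω, e z (a+1) ∉ ω}`), and two further named threads `p ≠ q` each with a fibre flag `SP, SQ ∈ {{0}, [1, L−1]}` (free /
prefix-frozen; a thread may be frozen only if every counted source of the class starts red on it).  `𝒱` is ANY up-closed event (in the class theorem it is
the HONEST event `𝒱 ∧ (above a source)`), levels are monotone `{0,1}`-valued.
* `Coefficientwise.bundle_class_scheme_count`: `#{σ ∈ R_a(z) : 𝒱, demand, hro, kbo} ≤ #{λ ∈ R_a(z) : 𝒱, supply, L₁, red-starting and not full on the frozen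
  threads}`.  This generalises `bundle_class_merged_count` (both flags free) of `…KernelMixBundleClassSchemes` to frozen `p`/`q`.
PROOF.  The abstract `fibre_system_count` (…KernelMixMergedScheme) on the REDUCED ground set `E' = E ∖ {e z 1, …, e z (a+1)}` with every predicate evaluated
on `ξ ∪ {e z 1..e z a}` (the class is a sub-cube, so `ξ ↦ ξ ∪ Z_a` is a bijection between `2^{E'}` and the class); `P = A p`, `Q = A q`; the transfer is
`bundle_fibre_transfer` with the class thread as a third prefix-frozen thread (kind PREFIX, length `a`) — valid on every bundle, in particular on chorded ones,
where the chord of a demand partner is the fully blue thread the transfer needs.  [cite: KozmaNitzan2024, Questions 8–9 (§5.5 p. 36) (context); Harris 1960]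
-/

namespace Summit.CriticalPhenomena.PercolationContinuityZ3.Theorems

open Finset Literature.Probability.Percolation

namespace Coefficientwise

variable {ι V : Type*}

open Classical in
/-- **Fibre scheme inside a red-prefix class, with two flag threads.**  Module docstring.  Memo gen 60 §1.
[cite: KozmaNitzan2024, Questions 8–9 (§5.5 p. 36) (context); Harris 1960] -/
theorem bundle_class_scheme_count (ends : ι → Sym2 V) (r : ℕ) (L : ℕ → ℕ) (hL : ∀ t, t < r → 1 ≤ L t)
    (w : ℕ → ℕ → V) (e : ℕ → ℕ → ι) (u b : V)
    (hw0 : ∀ t, t < r → w t 0 = u) (hwL : ∀ t, t < r → w t (L t) = b)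
    (harc : ∀ t, t < r → ∀ j, 1 ≤ j → j ≤ L t → ends (e t j) = s(w t (j - 1), w t j))
    (hwinj : ∀ t, t < r → ∀ i j, i ≤ L t → j ≤ L t → w t i = w t j → i = j)
    (hcross : ∀ t t', t < r → t' < r → t ≠ t' → ∀ i j, i ≤ L t → j ≤ L t' → w t i = w t' j → (i = 0 ∧ j = 0) ∨ (i = L t ∧ j = L t'))
    (A : ℕ → Finset ι) (hA : ∀ t, t < r → ∀ i, i ∈ A t ↔ ∃ j, 1 ≤ j ∧ j ≤ L t ∧ e t j = i)
    (hAdisj : ∀ t t', t < r → t' < r → t ≠ t' → Disjoint (A t) (A t'))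
    (E : Finset ι) (hEA : ∀ i, i ∈ E ↔ ∃ t, t < r ∧ i ∈ A t)
    (z p q : ℕ) (hz : z < r) (hp : p < r) (hq : q < r) (hzp : z ≠ p) (hzq : z ≠ q) (hpq : p ≠ q)
    (a : ℕ) (ha1 : 1 ≤ a) (haL : a + 1 ≤ L z)
    (𝒱 : Finset ι → Prop) (hV : ∀ ⦃s t : Finset ι⦄, s ⊆ t → 𝒱 s → 𝒱 t)
    (ha hb ka kb : Set V → ℝ) (mha : Monotone ha) (mhb : Monotone hb) (mka : Monotone ka) (mkb : Monotone kb)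
    (ha01 : ∀ S, ha S = 0 ∨ ha S = 1) (hb01 : ∀ S, hb S = 0 ∨ hb S = 1) (ka01 : ∀ S, ka S = 0 ∨ ka S = 1) (kb01 : ∀ S, kb S = 0 ∨ kb S = 1)
    (SP SQ : Finset ℕ) (hSP : SP = {0} ∨ SP = Finset.Icc 1 (L p - 1)) (hSQ : SQ = {0} ∨ SQ = Finset.Icc 1 (L q - 1))
    (covP : SP = Finset.Icc 1 (L p - 1) → ∀ σ, σ ⊆ E → ((∀ j, 1 ≤ j → j ≤ a → e z j ∈ σ) ∧ e z (a + 1) ∉ σ) →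
      (𝒱 σ ∧ (b ∈ openCluster (ends '' (↑(E \ σ) : Set ι)) u ∧ b ∉ openCluster (ends '' (↑σ : Set ι)) u) ∧
        (ha (openCluster (ends '' (↑σ : Set ι)) u) = 1 ∧ hb (openCluster (ends '' (↑(E \ σ) : Set ι)) u) = 0) ∧
        (kb (openCluster (ends '' (↑(E \ σ) : Set ι)) u) = 1 ∧ ka (openCluster (ends '' (↑σ : Set ι)) u) = 0)) → e p 1 ∈ σ)
    (covQ : SQ = Finset.Icc 1 (L q - 1) → ∀ σ, σ ⊆ E → ((∀ j, 1 ≤ j → j ≤ a → e z j ∈ σ) ∧ e z (a + 1) ∉ σ) →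
      (𝒱 σ ∧ (b ∈ openCluster (ends '' (↑(E \ σ) : Set ι)) u ∧ b ∉ openCluster (ends '' (↑σ : Set ι)) u) ∧
        (ha (openCluster (ends '' (↑σ : Set ι)) u) = 1 ∧ hb (openCluster (ends '' (↑(E \ σ) : Set ι)) u) = 0) ∧
        (kb (openCluster (ends '' (↑(E \ σ) : Set ι)) u) = 1 ∧ ka (openCluster (ends '' (↑σ : Set ι)) u) = 0)) → e q 1 ∈ σ) :
    ((E.powerset).filter (fun σ => ((∀ j, 1 ≤ j → j ≤ a → e z j ∈ σ) ∧ e z (a + 1) ∉ σ) ∧ 𝒱 σ ∧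
        (b ∈ openCluster (ends '' (↑(E \ σ) : Set ι)) u ∧ b ∉ openCluster (ends '' (↑σ : Set ι)) u) ∧
        (ha (openCluster (ends '' (↑σ : Set ι)) u) = 1 ∧ hb (openCluster (ends '' (↑(E \ σ) : Set ι)) u) = 0) ∧
        (kb (openCluster (ends '' (↑(E \ σ) : Set ι)) u) = 1 ∧ ka (openCluster (ends '' (↑σ : Set ι)) u) = 0))).card
    ≤ ((E.powerset).filter (fun lam => ((∀ j, 1 ≤ j → j ≤ a → e z j ∈ lam) ∧ e z (a + 1) ∉ lam) ∧ 𝒱 lam ∧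
        (b ∈ openCluster (ends '' (↑lam : Set ι)) u ∧ b ∉ openCluster (ends '' (↑(E \ lam) : Set ι)) u) ∧
        (ha (openCluster (ends '' (↑lam : Set ι)) u) = 1 ∧ kb (openCluster (ends '' (↑lam : Set ι)) u) = 1 ∧
          hb (openCluster (ends '' (↑(E \ lam) : Set ι)) u) = 0 ∧ ka (openCluster (ends '' (↑(E \ lam) : Set ι)) u) = 0) ∧
        (SP = Finset.Icc 1 (L p - 1) → e p 1 ∈ lam ∧ ¬ A p ⊆ lam) ∧ (SQ = Finset.Icc 1 (L q - 1) → e q 1 ∈ lam ∧ ¬ A q ⊆ lam))).card := by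
  set C : Finset ι → Set V := fun ω => openCluster (ends '' (↑ω : Set ι)) u with hC
  -- ## bundle bookkeeping
  have hr : 0 < r := lt_of_le_of_lt (Nat.zero_le z) hz
  have hAE : ∀ t, t < r → A t ⊆ E := fun t ht i hi => (hEA i).mpr ⟨t, ht, hi⟩
  have heA : ∀ t, t < r → ∀ j, 1 ≤ j → j ≤ L t → e t j ∈ A t := fun t ht j hj1 hjL => (hA t ht _).mpr ⟨j, hj1, hjL, rfl⟩
  have full_iff : ∀ ω : Finset ι, ω ⊆ E → (b ∈ C ω ↔ ∃ t, t < r ∧ A t ⊆ ω) := fun ω hω =>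
    bundle_b_mem_cluster_iff_threads ends r L hL w e u b hr hw0 hwL harc hwinj hcross A hA E hEA ω hω
  have einj : ∀ t, t < r → ∀ i j, 1 ≤ i → i ≤ L t → 1 ≤ j → j ≤ L t → e t i = e t j → i = j := by
    intro t ht i j hi1 hiL hj1 hjL hij
    have h := harc t ht i hi1 hiL
    rw [hij, harc t ht j hj1 hjL] at h
    rcases Sym2.eq_iff.mp h with ⟨h1, _⟩ | ⟨h1, h2⟩
    · have := hwinj t ht (j - 1) (i - 1) (by omega) (by omega) h1; omega
    · have e1 := hwinj t ht (j - 1) i (by omega) hiL h1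
      have e2 := hwinj t ht j (i - 1) hjL (by omega) h2
      omega
  -- 0/1 bookkeeping
  have one_of_ge : ∀ (f : Set V → ℝ), (∀ S, f S = 0 ∨ f S = 1) → ∀ S S' : Set V, S ⊆ S' → Monotone f → f S = 1 → f S' = 1 := by
    intro f f01 S S' hSS' mf h1
    rcases f01 S' with h0 | h0
    · have := mf hSS'; rw [h1, h0] at this; linarith
    · exact h0
  have zero_of_le : ∀ (f : Set V → ℝ), (∀ S, f S = 0 ∨ f S = 1) → ∀ S S' : Set V, S ⊆ S' → Monotone f → f S' = 0 → f S = 0 := by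
    intro f f01 S S' hSS' mf h0
    rcases f01 S with h1 | h1
    · exact h1
    · have := mf hSS'; rw [h1, h0] at this; linarith
  have Cmono : ∀ s t : Finset ι, s ⊆ t → C s ⊆ C t := fun s t hst => openCluster_image_mono ends hst u
  have Ccompl : ∀ s t : Finset ι, s ⊆ t → C (E \ t) ⊆ C (E \ s) := fun s t hst => Cmono _ _ (Finset.sdiff_subset_sdiff (le_refl E) hst)
  -- ## the class as a reduced ground set
  set Zfix : Finset ι := (Finset.Icc 1 (a + 1)).image (e z) with hZfix
  set Za : Finset ι := (Finset.Icc 1 a).image (e z) with hZa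
  set E' : Finset ι := E \ Zfix with hE'
  have memZfix : ∀ x, x ∈ Zfix ↔ ∃ j, 1 ≤ j ∧ j ≤ a + 1 ∧ e z j = x := by
    intro x; rw [hZfix, Finset.mem_image]
    constructor
    · rintro ⟨j, hj, rfl⟩; rw [Finset.mem_Icc] at hj; exact ⟨j, hj.1, hj.2, rfl⟩
    · rintro ⟨j, hj1, hj2, rfl⟩; exact ⟨j, Finset.mem_Icc.mpr ⟨hj1, hj2⟩, rfl⟩
  have memZa : ∀ x, x ∈ Za ↔ ∃ j, 1 ≤ j ∧ j ≤ a ∧ e z j = x := by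
    intro x; rw [hZa, Finset.mem_image]
    constructor
    · rintro ⟨j, hj, rfl⟩; rw [Finset.mem_Icc] at hj; exact ⟨j, hj.1, hj.2, rfl⟩
    · rintro ⟨j, hj1, hj2, rfl⟩; exact ⟨j, Finset.mem_Icc.mpr ⟨hj1, hj2⟩, rfl⟩
  have ZaZfix : Za ⊆ Zfix := fun x hx => by
    obtain ⟨j, hj1, hj2, rfl⟩ := (memZa x).mp hx; exact (memZfix _).mpr ⟨j, hj1, by omega, rfl⟩
  have ZfixAz : Zfix ⊆ A z := fun x hx => by
    obtain ⟨j, hj1, hj2, rfl⟩ := (memZfix x).mp hx; exact heA z hz j hj1 (by omega)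
  have ZaE : Za ⊆ E := ZaZfix.trans (ZfixAz.trans (hAE z hz))
  have ez_notin_Za : e z (a + 1) ∉ Za := fun hm => by
    obtain ⟨j, hj1, hj2, hj⟩ := (memZa _).mp hm
    have := einj z hz j (a + 1) hj1 (by omega) (by omega) haL hj; omega
  have hE'E : E' ⊆ E := Finset.sdiff_subset
  have hApE' : A p ⊆ E' := fun x hx => Finset.mem_sdiff.mpr ⟨hAE p hp hx, fun hm =>
    Finset.disjoint_left.mp (hAdisj p z hp hz hzp.symm) hx (ZfixAz hm)⟩
  have hAqE' : A q ⊆ E' := fun x hx => Finset.mem_sdiff.mpr ⟨hAE q hq hx, fun hm =>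
    Finset.disjoint_left.mp (hAdisj q z hq hz hzq.symm) hx (ZfixAz hm)⟩
  -- class membership of the lift, and the lift/restrict bijection
  obtain ⟨cls, hcls⟩ : ∃ f : Finset ι → Prop, f = fun ω => (∀ j, 1 ≤ j → j ≤ a → e z j ∈ ω) ∧ e z (a + 1) ∉ ω := ⟨_, rfl⟩
  have lift_cls : ∀ ξ, ξ ⊆ E' → cls (ξ ∪ Za) := by
    intro ξ hξ; rw [hcls]
    refine ⟨fun j hj1 hja => Finset.mem_union_right _ ((memZa _).mpr ⟨j, hj1, hja, rfl⟩), fun hm => ?_⟩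
    rcases Finset.mem_union.mp hm with h | h
    · exact (Finset.mem_sdiff.mp (hξ h)).2 ((memZfix _).mpr ⟨a + 1, by omega, le_refl _, rfl⟩)
    · exact ez_notin_Za h
  have lift_sub : ∀ ξ, ξ ⊆ E' → ξ ∪ Za ⊆ E := fun ξ hξ => Finset.union_subset (hξ.trans hE'E) ZaE
  have restrict_lift : ∀ ξ, ξ ⊆ E' → (ξ ∪ Za) \ Zfix = ξ := by
    intro ξ hξ; ext x
    rw [Finset.mem_sdiff, Finset.mem_union]
    constructor
    · rintro ⟨h | h, hx⟩
      · exact h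
      · exact absurd (ZaZfix h) hx
    · intro hx; exact ⟨Or.inl hx, (Finset.mem_sdiff.mp (hξ hx)).2⟩
  have cls_decomp : ∀ σ, σ ⊆ E → cls σ → σ \ Zfix ⊆ E' ∧ (σ \ Zfix) ∪ Za = σ := by
    intro σ hσ hc; rw [hcls] at hc
    refine ⟨Finset.sdiff_subset_sdiff hσ (le_refl _), ?_⟩
    ext x
    rw [Finset.mem_union, Finset.mem_sdiff]
    constructor
    · rintro (⟨hx, _⟩ | hx)
      · exact hx
      · obtain ⟨j, hj1, hj2, rfl⟩ := (memZa x).mp hx; exact hc.1 j hj1 hj2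
    · intro hx
      by_cases hxZ : x ∈ Zfix
      · obtain ⟨j, hj1, hj2, rfl⟩ := (memZfix x).mp hxZ
        by_cases hja : j ≤ a
        · exact Or.inr ((memZa _).mpr ⟨j, hj1, hja, rfl⟩)
        · have : j = a + 1 := by omega
          subst this; exact absurd hx hc.2
      · exact Or.inl ⟨hx, hxZ⟩
  have transport : ∀ Φ : Finset ι → Prop, ((E.powerset).filter (fun σ => cls σ ∧ Φ σ)).card = ((E'.powerset).filter (fun ξ => Φ (ξ ∪ Za))).card := by
    intro Φ
    have himg : (E.powerset).filter (fun σ => cls σ ∧ Φ σ) = ((E'.powerset).filter (fun ξ => Φ (ξ ∪ Za))).image (fun ξ => ξ ∪ Za) := by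
      ext σ
      rw [Finset.mem_filter, Finset.mem_powerset, Finset.mem_image]
      constructor
      · rintro ⟨hσ, hc, hΦ⟩
        obtain ⟨h1, h2⟩ := cls_decomp σ hσ hc
        exact ⟨σ \ Zfix, Finset.mem_filter.mpr ⟨Finset.mem_powerset.mpr h1, by rw [h2]; exact hΦ⟩, h2⟩
      · rintro ⟨ξ, hξ, rfl⟩
        rw [Finset.mem_filter, Finset.mem_powerset] at hξ
        exact ⟨lift_sub ξ hξ.1, lift_cls ξ hξ.1, hξ.2⟩
    rw [himg, Finset.card_image_of_injOn]
    intro ξ hξ ξ' hξ' heq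
    rw [Finset.mem_coe, Finset.mem_filter, Finset.mem_powerset] at hξ hξ'
    have h1 := restrict_lift ξ hξ.1
    have h2 := restrict_lift ξ' hξ'.1
    have := congrArg (fun s : Finset ι => s \ Zfix) heq
    simp only at this
    rwa [h1, h2] at this
  -- ## the predicates on the reduced ground set
  obtain ⟨Vp, hVp⟩ : ∃ f : Finset ι → Prop, f = fun ξ => 𝒱 (ξ ∪ Za) := ⟨_, rfl⟩
  obtain ⟨Hro, hHro⟩ : ∃ f : Finset ι → Prop, f = fun ξ => ha (C (ξ ∪ Za)) = 1 ∧ hb (C (E \ (ξ ∪ Za))) = 0 := ⟨_, rfl⟩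
  obtain ⟨Kbo, hKbo⟩ : ∃ f : Finset ι → Prop, f = fun ξ => kb (C (E \ (ξ ∪ Za))) = 1 ∧ ka (C (ξ ∪ Za)) = 0 := ⟨_, rfl⟩
  obtain ⟨N, hN⟩ : ∃ f : Finset ι → Prop, f = fun ξ => b ∈ C (E \ (ξ ∪ Za)) ∧ b ∉ C (ξ ∪ Za) := ⟨_, rfl⟩
  obtain ⟨T, hTd⟩ : ∃ f : Finset ι → Prop, f = fun ξ => cls (ξ ∪ Za) ∧ 𝒱 (ξ ∪ Za) ∧ (b ∈ C (ξ ∪ Za) ∧ b ∉ C (E \ (ξ ∪ Za))) ∧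
      (ha (C (ξ ∪ Za)) = 1 ∧ kb (C (ξ ∪ Za)) = 1 ∧ hb (C (E \ (ξ ∪ Za))) = 0 ∧ ka (C (E \ (ξ ∪ Za))) = 0) ∧
      (SP = Finset.Icc 1 (L p - 1) → e p 1 ∈ ξ ∪ Za ∧ ¬ A p ⊆ ξ ∪ Za) ∧ (SQ = Finset.Icc 1 (L q - 1) → e q 1 ∈ ξ ∪ Za ∧ ¬ A q ⊆ ξ ∪ Za) := ⟨_, rfl⟩
  have mono_lift : ∀ s t : Finset ι, s ⊆ t → s ∪ Za ⊆ t ∪ Za := fun s t hst => Finset.union_subset_union hst (le_refl _)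
  have V_mono : ∀ s t : Finset ι, s ⊆ t → Vp s → Vp t := by
    intro s t hst hs; rw [hVp] at hs ⊢; exact hV (mono_lift s t hst) hs
  have hro_mono : ∀ s t : Finset ι, s ⊆ t → Hro s → Hro t := by
    intro s t hst hs; rw [hHro] at hs ⊢
    exact ⟨one_of_ge ha ha01 _ _ (Cmono _ _ (mono_lift s t hst)) mha hs.1, zero_of_le hb hb01 _ _ (Ccompl _ _ (mono_lift s t hst)) mhb hs.2⟩
  have kbo_anti : ∀ s t : Finset ι, s ⊆ t → Kbo t → Kbo s := by
    intro s t hst ht; rw [hKbo] at ht ⊢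
    exact ⟨one_of_ge kb kb01 _ _ (Ccompl _ _ (mono_lift s t hst)) mkb ht.1, zero_of_le ka ka01 _ _ (Cmono _ _ (mono_lift s t hst)) mka ht.2⟩
  have N_anti : ∀ s t : Finset ι, s ⊆ t → N t → N s := by
    intro s t hst ht; rw [hN] at ht ⊢
    exact ⟨Ccompl _ _ (mono_lift s t hst) ht.1, fun hm => ht.2 (Cmono _ _ (mono_lift s t hst) hm)⟩
  have hNPQ : ∀ σ, σ ⊆ E' → N σ → ¬ A p ⊆ σ ∧ ¬ A q ⊆ σ := by
    intro σ hσ hn; rw [hN] at hn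
    exact ⟨fun hsub => hn.2 ((full_iff _ (lift_sub σ hσ)).mpr ⟨p, hp, hsub.trans Finset.subset_union_left⟩),
      fun hsub => hn.2 ((full_iff _ (lift_sub σ hσ)).mpr ⟨q, hq, hsub.trans Finset.subset_union_left⟩)⟩
  have ep_notin_Za : ∀ t, t < r → t ≠ z → ∀ j, 1 ≤ j → j ≤ L t → e t j ∉ Za := fun t ht htz j hj1 hjL hm =>
    Finset.disjoint_left.mp (hAdisj t z ht hz htz) (heA t ht j hj1 hjL) (ZaZfix.trans ZfixAz hm)
  have covP' : SP = Finset.Icc 1 (L p - 1) → ∀ σ, σ ⊆ E' → (Vp σ ∧ N σ ∧ Hro σ ∧ Kbo σ) → e p 1 ∈ σ := by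
    intro hS σ hσ hs
    rw [hVp, hN, hHro, hKbo] at hs
    have h := covP hS (σ ∪ Za) (lift_sub σ hσ) (by have := lift_cls σ hσ; rw [hcls] at this; exact this) ⟨hs.1, hs.2.1, hs.2.2.1, hs.2.2.2⟩
    rcases Finset.mem_union.mp h with h | h
    · exact h
    · exact absurd h (ep_notin_Za p hp hzp.symm 1 (le_refl 1) (hL p hp))
  have covQ' : SQ = Finset.Icc 1 (L q - 1) → ∀ σ, σ ⊆ E' → (Vp σ ∧ N σ ∧ Hro σ ∧ Kbo σ) → e q 1 ∈ σ := by
    intro hS σ hσ hs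
    rw [hVp, hN, hHro, hKbo] at hs
    have h := covQ hS (σ ∪ Za) (lift_sub σ hσ) (by have := lift_cls σ hσ; rw [hcls] at this; exact this) ⟨hs.1, hs.2.1, hs.2.2.1, hs.2.2.2⟩
    rcases Finset.mem_union.mp h with h | h
    · exact h
    · exact absurd h (ep_notin_Za q hq hzq.symm 1 (le_refl 1) (hL q hq))
  -- ## transfer: the lift of a landing is an L₁-supply point of 𝒱 in the class
  have transfer : ∀ i c : ℕ, i ∈ SP → c ∈ SQ → i < L p → c < L q → ∀ ξ ρ : Finset ι, ξ ⊆ E' → ρ ⊆ E' →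
      (∀ j, 1 ≤ j → j ≤ i → e p j ∈ ξ ∧ e p j ∈ ρ) → (1 ≤ i → e p (i + 1) ∉ ξ ∧ e p (i + 1) ∉ ρ) →
      (∀ j, 1 ≤ j → j ≤ L p → (i = 0 ∨ i + 2 ≤ j) → (e p j ∈ ρ ↔ e p j ∉ ξ)) →
      (∀ j, 1 ≤ j → j ≤ c → e q j ∈ ξ ∧ e q j ∈ ρ) → (1 ≤ c → e q (c + 1) ∉ ξ ∧ e q (c + 1) ∉ ρ) →
      (∀ j, 1 ≤ j → j ≤ L q → (c = 0 ∨ c + 2 ≤ j) → (e q j ∈ ρ ↔ e q j ∉ ξ)) →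
      (∀ x, x ∈ E' → x ∉ A p → x ∉ A q → (x ∈ ρ ↔ x ∉ ξ)) →
      Vp ξ → Hro ξ → Kbo ρ → N ρ → T ξ := by
    intro i c hiS hcS hiL hcL ξ ρ hξ hρ hPa hPa1 hPfree hQc hQc1 hQfree hrest hv hh hk hn
    rw [hVp] at hv; rw [hHro] at hh; rw [hKbo] at hk; rw [hN] at hn
    set ξ' : Finset ι := ξ ∪ Za with hξ'
    set ρ' : Finset ι := ρ ∪ Za with hρ'
    have hξ'E : ξ' ⊆ E := lift_sub ξ hξ
    have hρ'E : ρ' ⊆ E := lift_sub ρ hρ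
    -- membership bookkeeping in the lifts
    have mem_lift_of_notZa : ∀ (s : Finset ι) (x : ι), x ∉ Za → (x ∈ s ∪ Za ↔ x ∈ s) := by
      intro s x hx; rw [Finset.mem_union]
      exact ⟨fun h => h.resolve_right hx, fun h => Or.inl h⟩
    obtain ⟨κ, hκ⟩ : ∃ f : ℕ → ℕ, f = fun _ => 2 := ⟨_, rfl⟩
    obtain ⟨al, hal⟩ : ∃ f : ℕ → ℕ, f = fun t => if t = z then a else if t = p then i else if t = q then c else 0 := ⟨_, rfl⟩
    have halz : al z = a := by rw [hal]; simp
    have halp : al p = i := by rw [hal]; simp [hzp.symm]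
    have halq : al q = c := by rw [hal]; simp [hzq.symm, hpq.symm]
    have halo : ∀ t, t ≠ z → t ≠ p → t ≠ q → al t = 0 := by intro t h1 h2 h3; rw [hal]; simp [h1, h2, h3]
    have hnf : ∀ t, t < r → ∃ j, 1 ≤ j ∧ j ≤ L t ∧ e t j ∉ ρ' := by
      intro t ht
      by_contra hno
      push Not at hno
      exact hn.2 ((full_iff ρ' hρ'E).mpr ⟨t, ht, fun x hx => by
        obtain ⟨j, hj1, hjL, rfl⟩ := (hA t ht x).mp hx
        exact hno j hj1 hjL⟩)
    have hempty : ∃ t, t < r ∧ ∀ j, 1 ≤ j → j ≤ L t → e t j ∉ ρ' := by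
      obtain ⟨t, ht, hsub⟩ := (full_iff (E \ ρ') Finset.sdiff_subset).mp hn.1
      exact ⟨t, ht, fun j hj1 hjL => (Finset.mem_sdiff.mp (hsub (heA t ht j hj1 hjL))).2⟩
    have key := bundle_fibre_transfer ends r L hL w e u b hw0 hwL harc hwinj hcross A hA E hEA κ al ξ' ρ' ξ' hξ'E
      (fun t ht j hj1 hjL => by rw [hκ]; simp)
      (fun t ht h1 => by rw [hκ] at h1; exact absurd h1 (by norm_num))
      (fun t ht _ => by
        by_cases htz : t = z
        · subst htz; rw [halz]
          refine ⟨by omega, fun j hj1 hja => ⟨Finset.mem_union_right _ ((memZa _).mpr ⟨j, hj1, hja, rfl⟩),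
            Finset.mem_union_right _ ((memZa _).mpr ⟨j, hj1, hja, rfl⟩)⟩, fun _ => ⟨?_, ?_⟩, fun j hj1 hjL hj2 => ?_⟩
          · intro hm
            rcases Finset.mem_union.mp hm with h | h
            · exact (Finset.mem_sdiff.mp (hξ h)).2 ((memZfix _).mpr ⟨a + 1, by omega, le_refl _, rfl⟩)
            · exact ez_notin_Za h
          · intro hm
            rcases Finset.mem_union.mp hm with h | h
            · exact (Finset.mem_sdiff.mp (hρ h)).2 ((memZfix _).mpr ⟨a + 1, by omega, le_refl _, rfl⟩)
            · exact ez_notin_Za h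
          · have hj : a + 2 ≤ j := by rcases hj2 with h | h <;> omega
            have hxZa : e t j ∉ Za := fun hm => by
              obtain ⟨j', hj'1, hj'2, hj'⟩ := (memZa _).mp hm
              have := einj t ht j' j hj'1 (by omega) hj1 hjL hj'; omega
            have hxZfix : e t j ∉ Zfix := fun hm => by
              obtain ⟨j', hj'1, hj'2, hj'⟩ := (memZfix _).mp hm
              have := einj t ht j' j hj'1 (by omega) hj1 hjL hj'; omega
            have hxE' : e t j ∈ E' := Finset.mem_sdiff.mpr ⟨hAE t ht (heA t ht j hj1 hjL), hxZfix⟩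
            rw [mem_lift_of_notZa ρ _ hxZa, mem_lift_of_notZa ξ _ hxZa]
            exact hrest (e t j) hxE' (fun hm => Finset.disjoint_left.mp (hAdisj t p ht hp hzp) (heA t ht j hj1 hjL) hm)
              (fun hm => Finset.disjoint_left.mp (hAdisj t q ht hq hzq) (heA t ht j hj1 hjL) hm)
        by_cases htp : t = p
        · subst htp; rw [halp]
          have nZ : ∀ j, 1 ≤ j → j ≤ L t → e t j ∉ Za := fun j hj1 hjL => ep_notin_Za t ht htz j hj1 hjL
          refine ⟨hiL, fun j hj1 hji => ?_, fun hi1 => ?_, fun j hj1 hjL hj2 => ?_⟩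
          · rw [mem_lift_of_notZa ξ _ (nZ j hj1 (by omega)), mem_lift_of_notZa ρ _ (nZ j hj1 (by omega))]; exact hPa j hj1 hji
          · rw [mem_lift_of_notZa ξ _ (nZ (i + 1) (by omega) (by omega)), mem_lift_of_notZa ρ _ (nZ (i + 1) (by omega) (by omega))]
            exact hPa1 hi1
          · rw [mem_lift_of_notZa ρ _ (nZ j hj1 hjL), mem_lift_of_notZa ξ _ (nZ j hj1 hjL)]; exact hPfree j hj1 hjL hj2
        by_cases htq : t = q
        · subst htq; rw [halq]
          have nZ : ∀ j, 1 ≤ j → j ≤ L t → e t j ∉ Za := fun j hj1 hjL => ep_notin_Za t ht htz j hj1 hjL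
          refine ⟨hcL, fun j hj1 hji => ?_, fun hc1 => ?_, fun j hj1 hjL hj2 => ?_⟩
          · rw [mem_lift_of_notZa ξ _ (nZ j hj1 (by omega)), mem_lift_of_notZa ρ _ (nZ j hj1 (by omega))]; exact hQc j hj1 hji
          · rw [mem_lift_of_notZa ξ _ (nZ (c + 1) (by omega) (by omega)), mem_lift_of_notZa ρ _ (nZ (c + 1) (by omega) (by omega))]
            exact hQc1 hc1
          · rw [mem_lift_of_notZa ρ _ (nZ j hj1 hjL), mem_lift_of_notZa ξ _ (nZ j hj1 hjL)]; exact hQfree j hj1 hjL hj2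
        rw [halo t htz htp htq]
        refine ⟨Nat.lt_of_lt_of_le Nat.zero_lt_one (hL t ht), fun j hj1 hj0 => by omega, fun h => by omega, fun j hj1 hjL _ => ?_⟩
        have nZ : e t j ∉ Za := ep_notin_Za t ht htz j hj1 hjL
        have hxE' : e t j ∈ E' := Finset.mem_sdiff.mpr ⟨hAE t ht (heA t ht j hj1 hjL), fun hm =>
          Finset.disjoint_left.mp (hAdisj t z ht hz htz) (heA t ht j hj1 hjL) (ZfixAz hm)⟩
        rw [mem_lift_of_notZa ρ _ nZ, mem_lift_of_notZa ξ _ nZ]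
        exact hrest (e t j) hxE' (fun hm => Finset.disjoint_left.mp (hAdisj t p ht hp htp) (heA t ht j hj1 hjL) hm)
          (fun hm => Finset.disjoint_left.mp (hAdisj t q ht hq htq) (heA t ht j hj1 hjL) hm))
      (fun t ht => by rw [hκ]; exact Or.inr (Or.inr rfl)) hnf hempty
    obtain ⟨hbX, hbY, T2, T3⟩ := key
    rw [hTd]
    refine ⟨lift_cls ξ hξ, hv, ⟨hbX, hbY⟩, ⟨hh.1, one_of_ge kb kb01 _ _ T2 mkb hk.1, hh.2, zero_of_le ka ka01 _ _ T3 mka hk.2⟩, ?_, ?_⟩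
    · intro hS
      have hi1 : 1 ≤ i := by rw [hS, Finset.mem_Icc] at hiS; exact hiS.1
      refine ⟨Finset.mem_union_left _ (hPa 1 (le_refl 1) hi1).1, fun hsub => (hPa1 hi1).1 ?_⟩
      have hm := hsub (heA p hp (i + 1) (by omega) (by omega))
      rcases Finset.mem_union.mp hm with h | h
      · exact h
      · exact absurd h (ep_notin_Za p hp hzp.symm (i + 1) (by omega) (by omega))
    · intro hS
      have hc1 : 1 ≤ c := by rw [hS, Finset.mem_Icc] at hcS; exact hcS.1
      refine ⟨Finset.mem_union_left _ (hQc 1 (le_refl 1) hc1).1, fun hsub => (hQc1 hc1).1 ?_⟩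
      have hm := hsub (heA q hq (c + 1) (by omega) (by omega))
      rcases Finset.mem_union.mp hm with h | h
      · exact h
      · exact absurd h (ep_notin_Za q hq hzq.symm (c + 1) (by omega) (by omega))
  -- ## the abstract theorem on the reduced ground set
  have key := fibre_system_count E' (A p) (A q) hApE' hAqE' (hAdisj p q hp hq hpq) (L p) (L q) (hL p hp) (hL q hq) (e p) (e q)
    (heA p hp) (einj p hp) (fun x hx => (hA p hp x).mp hx) (heA q hq) (einj q hq) (fun x hx => (hA q hq x).mp hx)
    Vp Hro Kbo N T V_mono hro_mono kbo_anti N_anti hNPQ SP SQ hSP hSQ covP' covQ' transfer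
  -- ## transport back to the class
  have lhs := transport (fun σ => 𝒱 σ ∧ (b ∈ C (E \ σ) ∧ b ∉ C σ) ∧ (ha (C σ) = 1 ∧ hb (C (E \ σ)) = 0) ∧ (kb (C (E \ σ)) = 1 ∧ ka (C σ) = 0))
  have rhs := transport (fun lam => 𝒱 lam ∧ (b ∈ C lam ∧ b ∉ C (E \ lam)) ∧
      (ha (C lam) = 1 ∧ kb (C lam) = 1 ∧ hb (C (E \ lam)) = 0 ∧ ka (C (E \ lam)) = 0) ∧
      (SP = Finset.Icc 1 (L p - 1) → e p 1 ∈ lam ∧ ¬ A p ⊆ lam) ∧ (SQ = Finset.Icc 1 (L q - 1) → e q 1 ∈ lam ∧ ¬ A q ⊆ lam))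
  have e1 : (E'.powerset).filter (fun ξ => Vp ξ ∧ N ξ ∧ Hro ξ ∧ Kbo ξ) =
      (E'.powerset).filter (fun ξ => 𝒱 (ξ ∪ Za) ∧ (b ∈ C (E \ (ξ ∪ Za)) ∧ b ∉ C (ξ ∪ Za)) ∧
        (ha (C (ξ ∪ Za)) = 1 ∧ hb (C (E \ (ξ ∪ Za))) = 0) ∧ (kb (C (E \ (ξ ∪ Za))) = 1 ∧ ka (C (ξ ∪ Za)) = 0)) :=
    Finset.filter_congr fun ξ _ => by rw [hVp, hN, hHro, hKbo]
  have e2 : (E'.powerset).filter (fun ξ => T ξ) =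
      (E'.powerset).filter (fun ξ => 𝒱 (ξ ∪ Za) ∧ (b ∈ C (ξ ∪ Za) ∧ b ∉ C (E \ (ξ ∪ Za))) ∧
        (ha (C (ξ ∪ Za)) = 1 ∧ kb (C (ξ ∪ Za)) = 1 ∧ hb (C (E \ (ξ ∪ Za))) = 0 ∧ ka (C (E \ (ξ ∪ Za))) = 0) ∧
        (SP = Finset.Icc 1 (L p - 1) → e p 1 ∈ ξ ∪ Za ∧ ¬ A p ⊆ ξ ∪ Za) ∧ (SQ = Finset.Icc 1 (L q - 1) → e q 1 ∈ ξ ∪ Za ∧ ¬ A q ⊆ ξ ∪ Za)) := by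
    apply Finset.filter_congr
    intro ξ hξ
    rw [Finset.mem_powerset] at hξ
    rw [hTd]
    exact ⟨fun h => h.2, fun h => ⟨lift_cls ξ hξ, h⟩⟩
  rw [e1, e2] at key
  have cls_eq : ∀ ω : Finset ι, cls ω ↔ ((∀ j, 1 ≤ j → j ≤ a → e z j ∈ ω) ∧ e z (a + 1) ∉ ω) := fun ω => by rw [hcls]
  have lhs' : ((E.powerset).filter (fun σ => ((∀ j, 1 ≤ j → j ≤ a → e z j ∈ σ) ∧ e z (a + 1) ∉ σ) ∧ 𝒱 σ ∧ (b ∈ C (E \ σ) ∧ b ∉ C σ) ∧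
      (ha (C σ) = 1 ∧ hb (C (E \ σ)) = 0) ∧ (kb (C (E \ σ)) = 1 ∧ ka (C σ) = 0))).card =
      ((E.powerset).filter (fun σ => cls σ ∧ 𝒱 σ ∧ (b ∈ C (E \ σ) ∧ b ∉ C σ) ∧ (ha (C σ) = 1 ∧ hb (C (E \ σ)) = 0) ∧
        (kb (C (E \ σ)) = 1 ∧ ka (C σ) = 0))).card := by
    congr 1; exact Finset.filter_congr fun σ _ => by rw [cls_eq]
  have rhs' : ((E.powerset).filter (fun lam => ((∀ j, 1 ≤ j → j ≤ a → e z j ∈ lam) ∧ e z (a + 1) ∉ lam) ∧ 𝒱 lam ∧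
      (b ∈ C lam ∧ b ∉ C (E \ lam)) ∧ (ha (C lam) = 1 ∧ kb (C lam) = 1 ∧ hb (C (E \ lam)) = 0 ∧ ka (C (E \ lam)) = 0) ∧
      (SP = Finset.Icc 1 (L p - 1) → e p 1 ∈ lam ∧ ¬ A p ⊆ lam) ∧ (SQ = Finset.Icc 1 (L q - 1) → e q 1 ∈ lam ∧ ¬ A q ⊆ lam))).card =
      ((E.powerset).filter (fun lam => cls lam ∧ 𝒱 lam ∧ (b ∈ C lam ∧ b ∉ C (E \ lam)) ∧
        (ha (C lam) = 1 ∧ kb (C lam) = 1 ∧ hb (C (E \ lam)) = 0 ∧ ka (C (E \ lam)) = 0) ∧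
        (SP = Finset.Icc 1 (L p - 1) → e p 1 ∈ lam ∧ ¬ A p ⊆ lam) ∧ (SQ = Finset.Icc 1 (L q - 1) → e q 1 ∈ lam ∧ ¬ A q ⊆ lam))).card := by
    congr 1; exact Finset.filter_congr fun σ _ => by rw [cls_eq]
  have goal : ((E.powerset).filter (fun σ => cls σ ∧ 𝒱 σ ∧ (b ∈ C (E \ σ) ∧ b ∉ C σ) ∧ (ha (C σ) = 1 ∧ hb (C (E \ σ)) = 0) ∧
        (kb (C (E \ σ)) = 1 ∧ ka (C σ) = 0))).card ≤
      ((E.powerset).filter (fun lam => cls lam ∧ 𝒱 lam ∧ (b ∈ C lam ∧ b ∉ C (E \ lam)) ∧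
        (ha (C lam) = 1 ∧ kb (C lam) = 1 ∧ hb (C (E \ lam)) = 0 ∧ ka (C (E \ lam)) = 0) ∧
        (SP = Finset.Icc 1 (L p - 1) → e p 1 ∈ lam ∧ ¬ A p ⊆ lam) ∧ (SQ = Finset.Icc 1 (L q - 1) → e q 1 ∈ lam ∧ ¬ A q ⊆ lam))).card := by
    refine le_trans (le_of_eq ?_) (le_trans key (le_of_eq ?_))
    · convert lhs using 2 <;> (ext x; simp only [Finset.mem_filter])
    · convert rhs.symm using 2 <;> (ext x; simp only [Finset.mem_filter])
  have fin : ((E.powerset).filter (fun σ => ((∀ j, 1 ≤ j → j ≤ a → e z j ∈ σ) ∧ e z (a + 1) ∉ σ) ∧ 𝒱 σ ∧ (b ∈ C (E \ σ) ∧ b ∉ C σ) ∧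
      (ha (C σ) = 1 ∧ hb (C (E \ σ)) = 0) ∧ (kb (C (E \ σ)) = 1 ∧ ka (C σ) = 0))).card ≤
      ((E.powerset).filter (fun lam => ((∀ j, 1 ≤ j → j ≤ a → e z j ∈ lam) ∧ e z (a + 1) ∉ lam) ∧ 𝒱 lam ∧
      (b ∈ C lam ∧ b ∉ C (E \ lam)) ∧ (ha (C lam) = 1 ∧ kb (C lam) = 1 ∧ hb (C (E \ lam)) = 0 ∧ ka (C (E \ lam)) = 0) ∧
      (SP = Finset.Icc 1 (L p - 1) → e p 1 ∈ lam ∧ ¬ A p ⊆ lam) ∧ (SQ = Finset.Icc 1 (L q - 1) → e q 1 ∈ lam ∧ ¬ A q ⊆ lam))).card := by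
    refine le_trans (le_of_eq ?_) (le_trans goal (le_of_eq ?_))
    · convert lhs' using 2
    · convert rhs'.symm using 2
  convert fin using 3
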